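import Summits.SmoothPoincare4.SmoothPoincare4.Theses.CommonDualRelay
import Literature.Topology.FourManifolds.SphereFamilySurgeryTransport

/-!
# Crux `DualPresentation` (stmt-SmoothPoincare4-15791) — split piece `WallNormalisation`
# (stmt-SmoothPoincare4-18146): birth skeleton `split-wall`

Line: Wall's diffeomorphism + transport.  Two registered stubs and the kernel-checked composition
`WallNormalisation_of : WallNormalisation` — proved from the two stubs used BY NAME (the only `sorry`s).

* `stub_wallTransvection` (the load-bearing stub; Wall 1964 *Diffeomorphisms* Thm 2 = Kirby 1989
  Thm X.2, tree fact `exists_diffeomorph_freeCohomologyMap_eq_of_isometryEquiv`, + Hurewicz): under the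
  hypotheses of `WallNormalisation` there is an ORIENTATION-PRESERVING self-diffeomorphism `ψ` of `N`
  with `Aᵢ ≃ ψ ∘ Cᵢ` for every `i` (realise the isometry `[Cᵢ] ↦ [Aᵢ] = ε[Cᵢ] + Σⱼ βᵢⱼ[Pⱼ]`,
  `[Pⱼ] ↦ ε[Pⱼ]`, `β` skew with zero diagonal because `Aᵢ·Aⱼ = 0 = Aᵢ²`, then homologous ⇒ homotopic
  in the simply connected `N`).
* `stub_geometricallyDual_transport` (naturality, size M): geometric duality of two framed systems is
  preserved by pushing both forward along an orientation-preserving diffeomorphism (double points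
  correspond bijectively, transversality by the chain rule, local signs by orientation preservation).
* PROVED glue: push `C`, `P` forward along `ψ` (`FramedSphereFamily.exists_map_diffeomorph`), surgery
  along `ψC` still gives `S⁴` (`FramedSphereFamily.IsSurgery.of_map_diffeomorph`), the core spheres of
  the push-forward are `ψ ∘ Cᵢ` (`FramedSphereFamily.sphere_eq_of_map`).
-/

set_option linter.dupNamespace false

namespace Summit.SmoothPoincare4.SmoothPoincare4.Cruxes.DualPresentation.SplitWall

open scoped Manifold ContDiff Topology ContinuousMap
open Literature.Topology.FourManifolds
open Summit.SmoothPoincare4.SmoothPoincare4.Theses.CommonDualRelay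

/-- Local notation: the standard spheres. -/
local notation "𝕊⁴" => (Metric.sphere (0 : EuclideanSpace ℝ (Fin 5)) 1)
local notation "𝕊²" => (Metric.sphere (0 : EuclideanSpace ℝ (Fin 3)) 1)

/-- STUB (load-bearing; Wall 1964 Thm 2 / Kirby 1989 Thm X.2 + Hurewicz): in a closed simply connected
smooth 4-manifold `N`, if `C` is a framed `k`-system geometrically dual to the framed `k`-system `P`
with surgery along `C` giving `S⁴`, and `A` is a framed `k`-system algebraically dual to `P`, then an
orientation-preserving self-diffeomorphism `ψ` of `N` carries each `Cᵢ` to a sphere homotopic to `Aᵢ`.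
(On paper: `N ≅ #k(S²×S²)` with `{[Cᵢ],[Pᵢ]}` hyperbolic — `Pᵢ² = 0` forces the even framings —,
`[Aᵢ] = ε[Cᵢ] + Σⱼ βᵢⱼ[Pⱼ]` with `β` skew, zero diagonal; Wall realises the isometry
`[Cᵢ] ↦ [Aᵢ]`, `[Pⱼ] ↦ ε[Pⱼ]` by a diffeomorphism of `#(k-1)(S²×S²) # S²×S²` (`k = 1`: identity);
`π₁ N = 1` turns homologous into homotopic.) -/
theorem stub_wallTransvection :
    ∀ (N : Type) [TopologicalSpace N] [T2Space N] [SecondCountableTopology N]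
      [ChartedSpace (EuclideanSpace ℝ (Fin 4)) N] [IsManifold (𝓡 4) ∞ N] [CompactSpace N]
      [SimplyConnectedSpace N] (oN : SmoothOrientation (𝓡 4) N) (oS oP o : SmoothOrientation (𝓡 2) 𝕊²)
      (k : ℕ) (A C P : FramedSphereFamily (𝓡 4) N (Fin k) 2 2),
      IsAlgebraicallyDual (𝓡 2) (𝓡 2) (𝓡 4) two_add_two_eq_four oS oP oN A.sphere P.sphere →
      IsGeometricallyDual (𝓡 2) (𝓡 2) (𝓡 4) two_add_two_eq_four o o oN C.sphere P.sphere →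
      C.IsSurgery (𝓡 4) 𝕊⁴ →
      ∃ ψ : N ≃ₘ⟮𝓡 4, 𝓡 4⟯ N, ψ.IsOrientationPreserving oN oN ∧
        ∀ i, (⟨A.sphere i, A.continuous_sphere i⟩ : C(𝕊², N)).Homotopic
          ⟨ψ ∘ C.sphere i, ψ.continuous.comp (C.continuous_sphere i)⟩ := by
  sorry

/-- STUB (naturality of geometric duality, size M): pushing two framed systems forward along an
orientation-preserving self-diffeomorphism preserves geometric duality with the same orientation
data (double points of `(ψ∘Cᵢ, ψ∘Pⱼ)` ↔ double points of `(Cᵢ, Pⱼ)`; transversality by the chain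
rule for `mfderiv`; the local sign at a crossing is unchanged because `ψ` preserves `oN`). -/
theorem stub_geometricallyDual_transport :
    ∀ (N : Type) [TopologicalSpace N] [T2Space N] [SecondCountableTopology N]
      [ChartedSpace (EuclideanSpace ℝ (Fin 4)) N] [IsManifold (𝓡 4) ∞ N] [CompactSpace N]
      (oN : SmoothOrientation (𝓡 4) N) (o : SmoothOrientation (𝓡 2) 𝕊²)
      (k : ℕ) (C P C' P' : FramedSphereFamily (𝓡 4) N (Fin k) 2 2) (ψ : N ≃ₘ⟮𝓡 4, 𝓡 4⟯ N),
      ψ.IsOrientationPreserving oN oN →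
      (∀ i q, C'.toFun i q = ψ (C.toFun i q)) → (∀ i q, P'.toFun i q = ψ (P.toFun i q)) →
      IsGeometricallyDual (𝓡 2) (𝓡 2) (𝓡 4) two_add_two_eq_four o o oN C.sphere P.sphere →
      IsGeometricallyDual (𝓡 2) (𝓡 2) (𝓡 4) two_add_two_eq_four o o oN C'.sphere P'.sphere := by
  sorry

/-- COMPOSITION (kernel-checked; the only `sorry`s are inside the two declared stubs, used here BY NAME): the two stubs give `WallNormalisation` — take Wall's
`ψ`, push `C`, `P` forward along it (`exists_map_diffeomorph`), transport the surgery clause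
(`IsSurgery.of_map_diffeomorph`) and the duality (stub 2), and read the homotopies off
`sphere_eq_of_map`. -/
theorem WallNormalisation_of :
    Summit.SmoothPoincare4.SmoothPoincare4.Theses.CommonDualRelay.WallNormalisation := by
  intro N _ _ _ _ _ _ _ oN oS oP o k A C P hAP hCP hC
  obtain ⟨ψ, hψ, hhom⟩ := stub_wallTransvection N oN oS oP o k A C P hAP hCP hC
  obtain ⟨C', hC'⟩ := C.exists_map_diffeomorph ψ
  obtain ⟨P', hP'⟩ := P.exists_map_diffeomorph ψ
  refine ⟨C', P', stub_geometricallyDual_transport N oN o k C P C' P' ψ hψ hC' hP' hCP, hC.of_map_diffeomorph ψ hC', fun i => ?_⟩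
  have hs : (⟨C'.sphere i, C'.continuous_sphere i⟩ : C(𝕊², N)) =
      ⟨ψ ∘ C.sphere i, ψ.continuous.comp (C.continuous_sphere i)⟩ := by
    ext v
    exact FramedSphereFamily.sphere_eq_of_map hC' i v
  rw [hs]
  exact hhom i

end Summit.SmoothPoincare4.SmoothPoincare4.Cruxes.DualPresentation.SplitWall
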